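import Literature.NumberTheory.Sieve.Maynard2016CubeEstimate
import Literature.NumberTheory.Sieve.Maynard2016KernelPolylog

/-!
# Maynard (2016), Lemma 6: one pair of cutoffs — `(log x)^k (log y)^k S = (1+o(1)) 𝔖° ∏∫F'F'' ∏∫G'G''` ((6.8)–(6.19))

Trunk: AntSieve / parity (Maynard 2016 large-gaps ladder, named fact
`Literature.NumberTheory.Sieve.Maynard2016.Lemma6MainTerm` of `Maynard2016Lemma6Split.lean`).

J. Maynard, *Large gaps between primes*, Ann. of Math. 183 (2016) = arXiv:1408.5110, §6, proof of
Lemma 6, displays (6.8)–(6.19): for one pair of products of smooth cutoffs the coupled `[d,d'],[e,e']`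
sum `S` of (6.8) satisfies, uniformly in `m` and the prime `q ∈ [x/2, x]`,
`(log x)^k (log y)^k S = 𝔖° (∏_ℓ ∫ F_ℓ' F_ℓ'') (∏_ℓ ∫ G_ℓ' G_ℓ'') + o(𝔖°)`, where
`𝔖° = ∏_{p≤w}(1−1/p)^{−2k} ∏_{w<p≤y}(1−ω_{m,q}(p)/p)(1−1/p)^{−2k}` (`singSmall · singLarge`).
This file PROVES it (`Maynard2016.eventually_norm_logpow_mul_coupledLcmSum_sub_le`) from the
tree's bricks: `S = ∫ Φ K` (`coupledLcmSum_eq_integral_freqKernel`, (6.10)), the cube estimate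
`eventually_norm_kernel_sub_model_le` ((6.16)–(6.18)), the crude bound
`eventually_norm_logpow_mul_kernel_le` with the rapid decay of the Fourier majorants off the cube
(Polymath's `PsiMaj`/`PsiMajB`, `offCube_bounds`), the model integral
`integral_coupledPhi_mul_pairModel` ((6.19), Fubini + `integral_fourierPhi_mul_pairModel`) and the
uniform lower bound `singLarge ≥ 1/2`.

## References

* J. Maynard, *Large gaps between primes*, Ann. of Math. (2) 183 (2016), 915–933; arXiv:1408.5110,
  §6, proof of Lemma 6, displays (6.8)–(6.19). [Maynard2016LargeGaps]
* D. H. J. Polymath, *Variants of the Selberg sieve, and bounded intervals containing many primes*,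
  Res. Math. Sci. 1 (2014), Art. 12; arXiv:1407.4897, proof of Lemma 4.1, pp. 12–13. [Polymath8b2014]
-/

noncomputable section

open Filter Finset Real MeasureTheory
open scoped BigOperators Topology

namespace Literature.NumberTheory.Sieve

namespace Maynard2016

open LcmEuler

/-! ### `singLarge ≥ 1/2` uniformly -/

/-- **`𝔖^{(w,y]}_{m,q} ≥ 1/2`** eventually, uniformly in `1 ≤ m ≤ x` and primes `x/2 ≤ q ≤ x`
(`∏_{w<p≤y}(1 + ν_p/p) ≥ 1` equals `singLarge · R` with `R ≤ e^{24k²/w} ≤ 3/2`).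
[cite: Maynard2016LargeGaps, §6 display (6.20)] -/
theorem eventually_half_le_singLarge {ε : ℝ} (hε0 : 0 < ε) (hε : ε ≤ 1 / 2) (k : ℕ) :
    ∀ᶠ x : ℕ in atTop, ∀ m q : ℕ, 1 ≤ m → m ≤ x → q.Prime → (x : ℝ) / 2 ≤ q → q ≤ x →
      1 / 2 ≤ singLarge k ε x m q := by
  have ha : Tendsto (fun x : ℕ => 24 * (k : ℝ) ^ 2 / (⌊wFun x⌋₊ + 1)) atTop (𝓝 0) := by
    have h1 : Tendsto (fun x : ℕ => ((⌊wFun x⌋₊ : ℝ) + 1)⁻¹) atTop (𝓝 0) := by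
      refine tendsto_inv_atTop_zero.comp (tendsto_atTop_atTop.2 fun C => ?_)
      obtain ⟨N, hN⟩ := (eventually_le_wFun C).exists_forall_of_atTop
      exact ⟨N, fun x hx => (hN x hx).trans (Nat.lt_floor_add_one (wFun x)).le⟩
    simpa [div_eq_mul_inv] using h1.const_mul (24 * (k : ℝ) ^ 2)
  have hexp : Tendsto (fun x : ℕ => Real.exp (24 * (k : ℝ) ^ 2 / (⌊wFun x⌋₊ + 1))) atTop (𝓝 1) := by
    have h := (Real.continuous_exp.tendsto 0).comp ha
    rwa [Real.exp_zero] at h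
  filter_upwards [hexp.eventually_le_const (show (1 : ℝ) < 3 / 2 by norm_num),
    eventually_le_wFun ((4 * k : ℕ) : ℝ), eventually_prime_dvd_Pw_of_dvd_hTuple_sub k,
    eventually_y_lt_half hε0 (by linarith)] with x hx h4k hdvd hyx
  intro m q hm1 hm hq hqx2 hqx
  have h4k' : 4 * k ≤ ⌊wFun x⌋₊ := Nat.le_floor h4k
  have hpos := singLarge_pos (by omega : 2 * k ≤ ⌊wFun x⌋₊) ε m q
  have hy0 : 0 ≤ y ε x := (Real.exp_pos _).le
  have hpq : ∀ p ∈ midPrimes ε x, ¬ p ∣ q := by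
    intro p hp hpq
    obtain ⟨hpp, -⟩ := not_dvd_Pw_of_mem_midPrimes hp
    have hpy : p ≤ ⌊y ε x⌋₊ := (Finset.mem_Ioc.1 (Finset.mem_filter.1 hp).1).2
    have hpq' : p = q := (Nat.prime_dvd_prime_iff_eq hpp hq).1 hpq
    have : (p : ℝ) ≤ y ε x := le_trans (by exact_mod_cast hpy) (Nat.floor_le hy0)
    rw [hpq'] at this
    linarith
  have hdist : ∀ p ∈ midPrimes ε x, ∀ i j : Fin k, i ≠ j →
      ¬ (p : ℤ) ∣ (hTuple k x j : ℤ) - hTuple k x i := by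
    intro p hp i j hij h
    obtain ⟨hpp, hpW⟩ := not_dvd_Pw_of_mem_midPrimes hp
    exact hpW (hdvd i j hij p hpp h)
  obtain ⟨R, hR, hR1⟩ := exists_prod_mid_eq_singLarge_mul (m := m) (q := q) (by omega) hpq hdist
  have hprod : 1 ≤ ∏ p ∈ midPrimes ε x, (1 + (coupledNu m (couplingSet k x m q) p : ℝ) / p) := by
    calc (1 : ℝ) = ∏ _p ∈ midPrimes ε x, (1 : ℝ) := by simp
      _ ≤ _ := Finset.prod_le_prod (fun _ _ => zero_le_one) fun p _ => by
          have : (0 : ℝ) ≤ (coupledNu m (couplingSet k x m q) p : ℝ) / p := by positivity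
          linarith
  have hRle : R ≤ 3 / 2 := by
    have := (abs_le.1 (hR1)).2
    linarith
  rw [hR] at hprod
  have : singLarge k ε x m q * R ≤ singLarge k ε x m q * (3 / 2) :=
    mul_le_mul_of_nonneg_left hRle hpos.le
  linarith

/-! ### The model integral ((6.19)) -/

section Pair

variable {k : ℕ} {F F' G G' : Fin k → ℝ → ℝ} {sF sF' sG sG' : Fin k → ℝ}
  (hF : ∀ i, IsSieveCutoff (F i) (sF i)) (hF' : ∀ i, IsSieveCutoff (F' i) (sF' i))
  (hG : ∀ j, IsSieveCutoff (G j) (sG j)) (hG' : ∀ j, IsSieveCutoff (G' j) (sG' j))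

/-- The model constant `c = (∏_ℓ ∫_0^∞ F_ℓ' F_ℓ'') (∏_ℓ ∫_0^∞ G_ℓ' G_ℓ'')`. [cite: Maynard2016LargeGaps, §6 display (6.19)] -/
def pairConst (F F' G G' : Fin k → ℝ → ℝ) : ℂ :=
  (∏ i, ((∫ t in Set.Ioi (0 : ℝ), deriv (F i) t * deriv (F' i) t : ℝ) : ℂ)) *
    ∏ j, ((∫ t in Set.Ioi (0 : ℝ), deriv (G j) t * deriv (G' j) t : ℝ) : ℂ)

/-- **(6.19)**: `∫ Φ(p) M(p.1) M(p.2) dp = (∏_ℓ ∫ F_ℓ' F_ℓ'') (∏_ℓ ∫ G_ℓ' G_ℓ'')` (Fubini over the two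
sides, then Polymath's `integral_fourierPhi_mul_pairModel` on each). [cite: Maynard2016LargeGaps, §6 display (6.19)] -/
theorem integral_coupledPhi_mul_pairModel :
    ∫ p : (Fin k → ℝ × ℝ) × (Fin k → ℝ × ℝ), coupledPhi hF hF' hG hG' p * (pairModel p.1 * pairModel p.2) =
      pairConst F F' G G' := by
  have h : ∀ p : (Fin k → ℝ × ℝ) × (Fin k → ℝ × ℝ),
      coupledPhi hF hF' hG hG' p * (pairModel p.1 * pairModel p.2) =
        (fourierPhi hF hF' p.1 * pairModel p.1) * (fourierPhi hG hG' p.2 * pairModel p.2) := by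
    intro p; unfold coupledPhi; ring
  simp_rw [h]
  rw [MeasureTheory.Measure.volume_eq_prod, integral_prod_mul
    (f := fun p₁ : Fin k → ℝ × ℝ => fourierPhi hF hF' p₁ * pairModel p₁)
    (g := fun p₂ : Fin k → ℝ × ℝ => fourierPhi hG hG' p₂ * pairModel p₂),
    integral_fourierPhi_mul_pairModel hF hF', integral_fourierPhi_mul_pairModel hG hG']
  rfl

/-! ### Majorant facts on the product space -/

/-- `‖Φ(p)‖ ≤ Ψ₁(p.1) Ψ₂(p.2)`. [folklore] -/
private theorem norm_coupledPhi_le (p : (Fin k → ℝ × ℝ) × (Fin k → ℝ × ℝ)) :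
    ‖coupledPhi hF hF' hG hG' p‖ ≤ PsiMaj hF hF' p.1 * PsiMaj hG hG' p.2 := by
  unfold coupledPhi
  rw [norm_mul]
  exact mul_le_mul (norm_fourierPhi_le hF hF' p.1) (norm_fourierPhi_le hG hG' p.2) (norm_nonneg _)
    (PsiMaj_nonneg hF hF' p.1)

/-- `‖Φ(p)‖ ‖M(p.1) M(p.2)‖ ≤ Ψ₁(p.1) Ψ₂(p.2)`. [folklore] -/
private theorem norm_coupledPhi_mul_pairModel_le (p : (Fin k → ℝ × ℝ) × (Fin k → ℝ × ℝ)) :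
    ‖coupledPhi hF hF' hG hG' p‖ * ‖pairModel p.1 * pairModel p.2‖ ≤
      PsiMaj hF hF' p.1 * PsiMaj hG hG' p.2 := by
  unfold coupledPhi
  rw [norm_mul, norm_mul, show ‖fourierPhi hF hF' p.1‖ * ‖fourierPhi hG hG' p.2‖ *
      (‖pairModel p.1‖ * ‖pairModel p.2‖) = (‖fourierPhi hF hF' p.1‖ * ‖pairModel p.1‖) *
        (‖fourierPhi hG hG' p.2‖ * ‖pairModel p.2‖) by ring]
  exact mul_le_mul (norm_fourierPhi_mul_pairModel_le hF hF' p.1)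
    (norm_fourierPhi_mul_pairModel_le hG hG' p.2) (by positivity) (PsiMaj_nonneg hF hF' p.1)

/-- The combined majorant used for the pointwise bound: `a Ψ₁Ψ₂ + b (Ψ^B₁ Ψ₂ + Ψ₁ Ψ^B₂)`. [folklore] -/
def pairMaj (n : ℕ) (a b : ℝ) (p : (Fin k → ℝ × ℝ) × (Fin k → ℝ × ℝ)) : ℝ :=
  a * (PsiMaj hF hF' p.1 * PsiMaj hG hG' p.2) +
    b * (PsiMajB hF hF' n p.1 * PsiMaj hG hG' p.2 + PsiMaj hF hF' p.1 * PsiMajB hG hG' n p.2)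

/-- The combined majorant is integrable, with integral `a I₁ I₂ + b (I^B₁ I₂ + I₁ I^B₂)`. [folklore] -/
private theorem integral_pairMaj (n : ℕ) (a b : ℝ) :
    Integrable (pairMaj hF hF' hG hG' n a b) ∧
      ∫ p, pairMaj hF hF' hG hG' n a b p =
        a * ((∫ p₁, PsiMaj hF hF' p₁) * ∫ p₂, PsiMaj hG hG' p₂) +
          b * ((∫ p₁, PsiMajB hF hF' n p₁) * (∫ p₂, PsiMaj hG hG' p₂) +
            (∫ p₁, PsiMaj hF hF' p₁) * ∫ p₂, PsiMajB hG hG' n p₂) := by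
  have h1 : Integrable (fun p : (Fin k → ℝ × ℝ) × (Fin k → ℝ × ℝ) =>
      PsiMaj hF hF' p.1 * PsiMaj hG hG' p.2) :=
    (integrable_PsiMaj hF hF').mul_prod (integrable_PsiMaj hG hG')
  have h2 : Integrable (fun p : (Fin k → ℝ × ℝ) × (Fin k → ℝ × ℝ) =>
      PsiMajB hF hF' n p.1 * PsiMaj hG hG' p.2) :=
    (integrable_PsiMajB hF hF' n).mul_prod (integrable_PsiMaj hG hG')
  have h3 : Integrable (fun p : (Fin k → ℝ × ℝ) × (Fin k → ℝ × ℝ) =>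
      PsiMaj hF hF' p.1 * PsiMajB hG hG' n p.2) :=
    (integrable_PsiMaj hF hF').mul_prod (integrable_PsiMajB hG hG' n)
  have h23 : Integrable (fun p : (Fin k → ℝ × ℝ) × (Fin k → ℝ × ℝ) =>
      PsiMajB hF hF' n p.1 * PsiMaj hG hG' p.2 + PsiMaj hF hF' p.1 * PsiMajB hG hG' n p.2) :=
    h2.add h3
  have hI : Integrable (pairMaj hF hF' hG hG' n a b) := by
    have h := (h1.const_mul a).add (h23.const_mul b)
    refine h.congr (ae_of_all _ fun p => ?_)
    simp only [pairMaj, Pi.add_apply]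
  refine ⟨hI, ?_⟩
  have hsplit : ∫ p, pairMaj hF hF' hG hG' n a b p =
      (∫ p : (Fin k → ℝ × ℝ) × (Fin k → ℝ × ℝ), a * (PsiMaj hF hF' p.1 * PsiMaj hG hG' p.2)) +
        ∫ p : (Fin k → ℝ × ℝ) × (Fin k → ℝ × ℝ),
          b * (PsiMajB hF hF' n p.1 * PsiMaj hG hG' p.2 + PsiMaj hF hF' p.1 * PsiMajB hG hG' n p.2) := by
    rw [← integral_add (h1.const_mul a) (h23.const_mul b)]
    rfl
  rw [hsplit, integral_const_mul, integral_const_mul, integral_add h2 h3, MeasureTheory.Measure.volume_eq_prod,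
    integral_prod_mul (f := PsiMaj hF hF') (g := PsiMaj hG hG'),
    integral_prod_mul (f := PsiMajB hF hF' n) (g := PsiMaj hG hG'),
    integral_prod_mul (f := PsiMaj hF hF') (g := PsiMajB hG hG' n)]

/-! ### The pointwise bound and the pair estimate -/

/-- The exponent `A = crudeExp k k + 2k` (`‖(log x)^k (log y)^k K‖ ≤ 2^{crudeExp} (log x)^A`). [folklore] -/
def tailExp (k : ℕ) : ℕ := crudeExp k k + 2 * k

/-- **The pointwise bound** ((6.16)–(6.18) on the cube, the crude bound and rapid decay off it):
eventually in `x`, for all `1 ≤ m ≤ x`, primes `x/2 ≤ q ≤ x` and ALL frequencies `p`,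
`‖Φ(p) ((log x)^k (log y)^k K(p) − 𝔖° M(p.1)M(p.2))‖ ≤
   η 𝔖° Ψ₁Ψ₂ + (2^{crudeExp} + 𝔖°)/(1 + √log x) · (Ψ^B₁ Ψ₂ + Ψ₁ Ψ^B₂)` with `B = 2·tailExp k + 1`.
[cite: Maynard2016LargeGaps, §6 displays (6.16)–(6.18)] -/
theorem eventually_pair_pointwise {ε : ℝ} (hε0 : 0 < ε) (hε : ε ≤ 1 / 2) {η : ℝ} (hη : 0 < η) :
    ∀ᶠ x : ℕ in atTop, ∀ m q : ℕ, 1 ≤ m → m ≤ x → q.Prime → (x : ℝ) / 2 ≤ q → q ≤ x →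
      ∀ p : (Fin k → ℝ × ℝ) × (Fin k → ℝ × ℝ),
        ‖coupledPhi hF hF' hG hG' p *
            ((Real.log x : ℂ) ^ k * (Real.log (y ε x) : ℂ) ^ k *
                coupledFreqKernel (Pw x) m (couplingSet k x m q) (x : ℝ) (y ε x) p -
              ((singSmall k x * singLarge k ε x m q : ℝ) : ℂ) * (pairModel p.1 * pairModel p.2))‖ ≤
          pairMaj hF hF' hG hG' (2 * tailExp k + 1) (η * (singSmall k x * singLarge k ε x m q))
            (((2 : ℝ) ^ crudeExp k k + singSmall k x * singLarge k ε x m q) / (1 + Real.sqrt (Real.log x))) p := by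
  filter_upwards [eventually_norm_kernel_sub_model_le hε0 hε k hη,
    eventually_norm_logpow_mul_kernel_le k, eventually_iteratedLogs, eventually_y_lt_half hε0 (by linarith),
    eventually_gt_atTop 1] with x hcube hcrude hlogs hyx hx1
  obtain ⟨hL, hL2, hL3, -, hL2L, -, -⟩ := hlogs
  intro m q hm1 hm hq hqx2 hqx p
  obtain ⟨hS0, hcube'⟩ := hcube m q hm1 hm hq hqx2 hqx
  have hε1 : ε < 1 := by linarith
  have hL0 : 0 < Real.log x := by linarith
  have hly : 0 < Real.log (y ε x) := log_y_pos hε (by linarith) (by linarith) hL3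
  have hy1 : 1 < y ε x := by
    by_contra h
    exact absurd (Real.log_nonpos (Real.exp_pos _).le (not_lt.1 h)) (not_le.2 hly)
  have hyx' : y ε x ≤ x := by linarith
  set S₀ : ℝ := singSmall k x * singLarge k ε x m q with hS₀
  set R : ℝ := Real.sqrt (Real.log x) with hRdef
  have hR0 : 0 ≤ R := Real.sqrt_nonneg _
  have hR1 : 0 < 1 + R := by linarith
  set X : ℂ := (Real.log x : ℂ) ^ k * (Real.log (y ε x) : ℂ) ^ k *
    coupledFreqKernel (Pw x) m (couplingSet k x m q) (x : ℝ) (y ε x) p with hX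
  set MM : ℂ := pairModel p.1 * pairModel p.2 with hMM
  have hΨ₁ := PsiMaj_nonneg hF hF' p.1
  have hΨ₂ := PsiMaj_nonneg hG hG' p.2
  have hΨB₁ := PsiMajB_nonneg hF hF' (2 * tailExp k + 1) p.1
  have hΨB₂ := PsiMajB_nonneg hG hG' (2 * tailExp k + 1) p.2
  have hΦ := norm_coupledPhi_le hF hF' hG hG' p
  have hΦM := norm_coupledPhi_mul_pairModel_le hF hF' hG hG' p
  have hsecond : 0 ≤ ((2 : ℝ) ^ crudeExp k k + S₀) / (1 + R) *
      (PsiMajB hF hF' (2 * tailExp k + 1) p.1 * PsiMaj hG hG' p.2 +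
        PsiMaj hF hF' p.1 * PsiMajB hG hG' (2 * tailExp k + 1) p.2) := by positivity
  unfold pairMaj
  by_cases hc : InCube R p.1 ∧ InCube R p.2
  · -- on the cube
    have h1 := hcube' p hc.1 hc.2
    rw [norm_mul]
    calc ‖coupledPhi hF hF' hG hG' p‖ * ‖X - (S₀ : ℂ) * MM‖
        ≤ ‖coupledPhi hF hF' hG hG' p‖ * (η * S₀ * ‖MM‖) := mul_le_mul_of_nonneg_left h1 (norm_nonneg _)
      _ = η * S₀ * (‖coupledPhi hF hF' hG hG' p‖ * ‖MM‖) := by ring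
      _ ≤ η * S₀ * (PsiMaj hF hF' p.1 * PsiMaj hG hG' p.2) :=
          mul_le_mul_of_nonneg_left hΦM (by positivity)
      _ ≤ _ := le_add_of_nonneg_right hsecond
  · -- off the cube
    have hXle : ‖X‖ ≤ (2 : ℝ) ^ crudeExp k k * R ^ (2 * tailExp k) := by
      refine (hcrude m (couplingSet k x m q) (y ε x) hy1 hyx' p).trans (le_of_eq ?_)
      have hR2 : R ^ 2 = Real.log x := by rw [hRdef, Real.sq_sqrt hL0.le]
      rw [show R ^ (2 * tailExp k) = Real.log x ^ tailExp k by rw [pow_mul, hR2], tailExp, pow_add,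
        mul_pow, ← hR2]
      ring
    have hstep : ‖X - (S₀ : ℂ) * MM‖ ≤ (2 : ℝ) ^ crudeExp k k * R ^ (2 * tailExp k) + S₀ * ‖MM‖ := by
      refine (norm_sub_le _ _).trans (add_le_add hXle (le_of_eq ?_))
      rw [norm_mul, Complex.norm_real, Real.norm_eq_abs, abs_of_pos hS0]
    -- the offending side
    set n : ℕ := 2 * tailExp k + 1 with hn
    have hn1 : 1 ≤ n := by omega
    have key : ∀ {Ψo ΨBo Ψg : ℝ} {po : Fin k → ℝ × ℝ}, ¬ InCube R po → 0 ≤ Ψo → 0 ≤ Ψg →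
        ΨBo = Ψo * ∑ i, ((1 + |(po i).1|) ^ n + (1 + |(po i).2|) ^ n) →
        ‖coupledPhi hF hF' hG hG' p‖ ≤ Ψo * Ψg →
        ‖coupledPhi hF hF' hG hG' p‖ * ‖MM‖ ≤ Ψo * Ψg →
        ‖coupledPhi hF hF' hG hG' p‖ * ‖X - (S₀ : ℂ) * MM‖ ≤
          ((2 : ℝ) ^ crudeExp k k + S₀) / (1 + R) * (ΨBo * Ψg) := by
      intro Ψo ΨBo Ψg po hpo hΨo hΨg hBo hΦ' hΦM'
      obtain ⟨hb1, hb2⟩ := offCube_bounds (ι := Fin k) hR0 hn1 hpo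
      have hnm : n - 1 = 2 * tailExp k := by omega
      rw [hnm] at hb1
      set T : ℝ := ∑ i, ((1 + |(po i).1|) ^ n + (1 + |(po i).2|) ^ n) with hT
      have hq1 : R ^ (2 * tailExp k) ≤ T / (1 + R) := by rw [le_div_iff₀ hR1]; linarith
      have hq2 : 1 ≤ T / (1 + R) := by rw [le_div_iff₀ hR1]; linarith
      calc ‖coupledPhi hF hF' hG hG' p‖ * ‖X - (S₀ : ℂ) * MM‖
          ≤ ‖coupledPhi hF hF' hG hG' p‖ * ((2 : ℝ) ^ crudeExp k k * R ^ (2 * tailExp k) + S₀ * ‖MM‖) :=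
            mul_le_mul_of_nonneg_left hstep (norm_nonneg _)
        _ = (2 : ℝ) ^ crudeExp k k * (‖coupledPhi hF hF' hG hG' p‖ * R ^ (2 * tailExp k)) +
              S₀ * (‖coupledPhi hF hF' hG hG' p‖ * ‖MM‖) := by ring
        _ ≤ (2 : ℝ) ^ crudeExp k k * (Ψo * Ψg * (T / (1 + R))) + S₀ * (Ψo * Ψg * (T / (1 + R))) := by
            have e1 : ‖coupledPhi hF hF' hG hG' p‖ * R ^ (2 * tailExp k) ≤ Ψo * Ψg * (T / (1 + R)) :=
              mul_le_mul hΦ' hq1 (by positivity) (by positivity)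
            have e2 : ‖coupledPhi hF hF' hG hG' p‖ * ‖MM‖ ≤ Ψo * Ψg * (T / (1 + R)) := by
              have := mul_le_mul hΦM' hq2 zero_le_one (by positivity)
              rwa [mul_one] at this
            exact add_le_add (mul_le_mul_of_nonneg_left e1 (by positivity))
              (mul_le_mul_of_nonneg_left e2 hS0.le)
        _ = ((2 : ℝ) ^ crudeExp k k + S₀) / (1 + R) * (ΨBo * Ψg) := by
            rw [hBo, div_eq_mul_inv, div_eq_mul_inv]; ring
    rw [norm_mul]
    refine le_trans ?_ (le_add_of_nonneg_left (by positivity))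
    rcases not_and_or.1 hc with hc1 | hc2
    · have h := key hc1 hΨ₁ hΨ₂ (PsiMajB_eq hF hF' n p.1) hΦ hΦM
      refine h.trans ?_
      have : 0 ≤ ((2 : ℝ) ^ crudeExp k k + S₀) / (1 + R) * (PsiMaj hF hF' p.1 * PsiMajB hG hG' n p.2) := by
        positivity
      rw [mul_add]; linarith
    · have hΦ' : ‖coupledPhi hF hF' hG hG' p‖ ≤ PsiMaj hG hG' p.2 * PsiMaj hF hF' p.1 := by
        rw [mul_comm]; exact hΦ
      have hΦM' : ‖coupledPhi hF hF' hG hG' p‖ * ‖MM‖ ≤ PsiMaj hG hG' p.2 * PsiMaj hF hF' p.1 := by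
        rw [mul_comm (PsiMaj hG hG' p.2)]; exact hΦM
      have h := key hc2 hΨ₂ hΨ₁ (PsiMajB_eq hG hG' n p.2) hΦ' hΦM'
      refine h.trans ?_
      have : 0 ≤ ((2 : ℝ) ^ crudeExp k k + S₀) / (1 + R) * (PsiMajB hF hF' n p.1 * PsiMaj hG hG' p.2) := by
        positivity
      rw [mul_comm (PsiMajB hG hG' n p.2)] at h
      rw [mul_add]; linarith

set_option maxHeartbeats 800000 in
include hF hF' hG hG' in
/-- **One pair of cutoffs, uniformly in `m, q`** ((6.8)–(6.19)): for `0 < ε ≤ 1/2`, cutoffs supported in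
`[0,1]`, and `η > 0`, eventually in `x : ℕ`, for all `1 ≤ m ≤ x` and all primes `x/2 ≤ q ≤ x`,
`‖(log x)^k (log y)^k S − 𝔖° c‖ ≤ η 𝔖°`, where `S = coupledLcmSum (P_w) m (couplingSet) F F' G G' x y x`
is the coupled sum of (6.8), `c = pairConst F F' G G'` and `𝔖° = singSmall k x · singLarge k ε x m q`.
[cite: Maynard2016LargeGaps, §6 displays (6.8)–(6.19)] -/
theorem eventually_norm_logpow_mul_coupledLcmSum_sub_le {ε : ℝ} (hε0 : 0 < ε) (hε : ε ≤ 1 / 2)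
    (hTF : ∀ i, sF i ≤ 1 ∧ sF' i ≤ 1) (hTG : ∀ j, sG j ≤ 1 ∧ sG' j ≤ 1) {η : ℝ} (hη : 0 < η) :
    ∀ᶠ x : ℕ in atTop, ∀ m q : ℕ, 1 ≤ m → m ≤ x → q.Prime → (x : ℝ) / 2 ≤ q → q ≤ x →
      ‖(Real.log x : ℂ) ^ k * (Real.log (y ε x) : ℂ) ^ k *
            coupledLcmSum (Pw x) m (couplingSet k x m q) F F' G G' (x : ℝ) (y ε x) x -
          ((singSmall k x * singLarge k ε x m q : ℝ) : ℂ) * pairConst F F' G G'‖ ≤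
        η * (singSmall k x * singLarge k ε x m q) := by
  -- the constants
  set n : ℕ := 2 * tailExp k + 1 with hn
  set I₁ : ℝ := ∫ p₁, PsiMaj hF hF' p₁ with hI₁
  set I₂ : ℝ := ∫ p₂, PsiMaj hG hG' p₂ with hI₂
  set IB₁ : ℝ := ∫ p₁, PsiMajB hF hF' n p₁ with hIB₁
  set IB₂ : ℝ := ∫ p₂, PsiMajB hG hG' n p₂ with hIB₂
  have hI₁0 : 0 ≤ I₁ := integral_nonneg (PsiMaj_nonneg hF hF')
  have hI₂0 : 0 ≤ I₂ := integral_nonneg (PsiMaj_nonneg hG hG')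
  have hIB₁0 : 0 ≤ IB₁ := integral_nonneg (PsiMajB_nonneg hF hF' n)
  have hIB₂0 : 0 ≤ IB₂ := integral_nonneg (PsiMajB_nonneg hG hG' n)
  set J : ℝ := IB₁ * I₂ + I₁ * IB₂ with hJ
  have hJ0 : 0 ≤ J := by positivity
  -- accuracy on the cube and the decay rate
  set η₁ : ℝ := η / (2 * (I₁ * I₂ + 1)) with hη₁
  have hη₁0 : 0 < η₁ := by positivity
  have hdec : Tendsto (fun x : ℕ => (2 * (2 : ℝ) ^ crudeExp k k + 1) * J / (1 + Real.sqrt (Real.log x)))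
      atTop (𝓝 0) := by
    have h1 : Tendsto (fun x : ℕ => 1 + Real.sqrt (Real.log (x : ℝ))) atTop atTop :=
      tendsto_atTop_add_const_left _ 1 (Real.tendsto_sqrt_atTop.comp
        (Real.tendsto_log_atTop.comp tendsto_natCast_atTop_atTop))
    simpa [div_eq_mul_inv] using (tendsto_inv_atTop_zero.comp h1).const_mul ((2 * (2 : ℝ) ^ crudeExp k k + 1) * J)
  filter_upwards [eventually_pair_pointwise hF hF' hG hG' hε0 hε hη₁0,
    eventually_half_le_singLarge hε0 hε k, hdec.eventually_le_const (half_pos hη),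
    eventually_iteratedLogs, eventually_y_lt_half hε0 (by linarith), eventually_gt_atTop 1]
    with x hpt hhalf hdecx hlogs hyx hx1
  obtain ⟨hL, hL2, hL3, -, hL2L, -, -⟩ := hlogs
  intro m q hm1 hm hq hqx2 hqx
  have hL0 : 0 < Real.log x := by linarith
  have hly : 0 < Real.log (y ε x) := log_y_pos hε (by linarith) (by linarith) hL3
  have hy1 : 1 < y ε x := by
    by_contra h
    exact absurd (Real.log_nonpos (Real.exp_pos _).le (not_lt.1 h)) (not_le.2 hly)
  have hyx' : y ε x ≤ x := by linarith
  have hx0 : (0 : ℝ) ≤ x := by positivity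
  set S₀ : ℝ := singSmall k x * singLarge k ε x m q with hS₀
  have hSL := hhalf m q hm1 hm hq hqx2 hqx
  have hSS : 1 ≤ singSmall k x := by
    unfold singSmall
    calc (1 : ℝ) = ∏ _p ∈ (Finset.Iic ⌊wFun x⌋₊).filter Nat.Prime, (1 : ℝ) := by simp
      _ ≤ _ := Finset.prod_le_prod (fun _ _ => zero_le_one) fun p hp => by
          have hp2 := (Finset.mem_filter.1 hp).2.two_le
          have hp1 : (1 : ℝ) < p := by exact_mod_cast hp2
          have h1 : 0 < 1 - 1 / (p : ℝ) := by rw [sub_pos, div_lt_one (by linarith)]; exact hp1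
          have h2 : 1 - 1 / (p : ℝ) ≤ 1 := by
            have : 0 ≤ 1 / (p : ℝ) := by positivity
            linarith
          exact one_le_inv_iff₀.2 ⟨pow_pos h1 _, pow_le_one₀ h1.le h2⟩
  have hS0half : 1 / 2 ≤ S₀ := by
    rw [hS₀]
    calc (1 : ℝ) / 2 = 1 * (1 / 2) := by ring
      _ ≤ singSmall k x * singLarge k ε x m q := mul_le_mul hSS hSL (by norm_num) (by linarith)
  have hS0pos : 0 < S₀ := by linarith
  -- `S = ∫ Φ K` with `D = x`
  have hD : supportBox (x : ℝ) (y ε x) 1 1 ≤ x := by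
    unfold supportBox
    rw [Real.rpow_one, Real.rpow_one, Nat.floor_natCast]
    exact max_le le_rfl ((Nat.floor_le_floor hyx').trans (Nat.floor_natCast x).le)
  rw [coupledLcmSum_eq_integral_freqKernel hF hF' hG hG' (Pw x) m (couplingSet k x m q) hy1 hyx'
    hTF hTG hD, ← integral_coupledPhi_mul_pairModel hF hF' hG hG']
  -- linearity: `L ∫ΦK − S₀ ∫ΦMM = ∫ Φ (L K − S₀ MM)`
  have hIK := integrable_coupledPhi_mul_freqKernel hF hF' hG hG' (Pw x) m (couplingSet k x m q) hy1 hyx'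
  have hIM : Integrable fun p : (Fin k → ℝ × ℝ) × (Fin k → ℝ × ℝ) =>
      coupledPhi hF hF' hG hG' p * (pairModel p.1 * pairModel p.2) := by
    have h := (integrable_fourierPhi_mul_pairModel hF hF').mul_prod
      (integrable_fourierPhi_mul_pairModel hG hG')
    refine h.congr (ae_of_all _ fun p => ?_)
    simp only [coupledPhi]; ring
  set L : ℂ := (Real.log x : ℂ) ^ k * (Real.log (y ε x) : ℂ) ^ k with hLdef
  have hIK' : Integrable fun p : (Fin k → ℝ × ℝ) × (Fin k → ℝ × ℝ) =>
      L * (coupledPhi hF hF' hG hG' p * coupledFreqKernel (Pw x) m (couplingSet k x m q) (x : ℝ) (y ε x) p) :=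
    hIK.const_mul L
  have hIM' : Integrable fun p : (Fin k → ℝ × ℝ) × (Fin k → ℝ × ℝ) =>
      (S₀ : ℂ) * (coupledPhi hF hF' hG hG' p * (pairModel p.1 * pairModel p.2)) :=
    hIM.const_mul _
  have hlin : (L * ∫ p, coupledPhi hF hF' hG hG' p *
        coupledFreqKernel (Pw x) m (couplingSet k x m q) (x : ℝ) (y ε x) p) -
      (S₀ : ℂ) * (∫ p, coupledPhi hF hF' hG hG' p * (pairModel p.1 * pairModel p.2)) =
      ∫ p, coupledPhi hF hF' hG hG' p *
        (L * coupledFreqKernel (Pw x) m (couplingSet k x m q) (x : ℝ) (y ε x) p -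
          (S₀ : ℂ) * (pairModel p.1 * pairModel p.2)) := by
    have e1 : (∫ p, coupledPhi hF hF' hG hG' p *
        (L * coupledFreqKernel (Pw x) m (couplingSet k x m q) (x : ℝ) (y ε x) p -
          (S₀ : ℂ) * (pairModel p.1 * pairModel p.2))) =
        ∫ p, (L * (coupledPhi hF hF' hG hG' p *
            coupledFreqKernel (Pw x) m (couplingSet k x m q) (x : ℝ) (y ε x) p) -
          (S₀ : ℂ) * (coupledPhi hF hF' hG hG' p * (pairModel p.1 * pairModel p.2))) :=
      integral_congr_ae (ae_of_all _ fun p => by ring)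
    rw [e1, integral_sub hIK' hIM', integral_const_mul, integral_const_mul]
  rw [hlin]
  -- integrate the pointwise bound
  obtain ⟨hImaj, hIval⟩ := integral_pairMaj hF hF' hG hG' n (η₁ * S₀)
    (((2 : ℝ) ^ crudeExp k k + S₀) / (1 + Real.sqrt (Real.log x)))
  have hbound := norm_integral_le_of_norm_le hImaj (ae_of_all _ fun p => hpt m q hm1 hm hq hqx2 hqx p)
  refine hbound.trans ?_
  rw [hIval, ← hI₁, ← hI₂, ← hIB₁, ← hIB₂, ← hJ]
  -- `η₁ S₀ I₁I₂ + (2^C + S₀)/(1+R) J ≤ η S₀`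
  have hR1 : 0 < 1 + Real.sqrt (Real.log x) := by positivity
  have h1 : η₁ * S₀ * (I₁ * I₂) ≤ η / 2 * S₀ := by
    have hI0 : 0 ≤ I₁ * I₂ := mul_nonneg hI₁0 hI₂0
    have h' : η₁ * (I₁ * I₂) ≤ η / 2 := by
      rw [hη₁, div_mul_eq_mul_div, div_le_div_iff₀ (by positivity) (by norm_num : (0:ℝ) < 2)]
      have e : η * (2 * (I₁ * I₂ + 1)) - η * (I₁ * I₂) * 2 = 2 * η := by ring
      linarith
    calc η₁ * S₀ * (I₁ * I₂) = η₁ * (I₁ * I₂) * S₀ := by ring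
      _ ≤ η / 2 * S₀ := mul_le_mul_of_nonneg_right h' hS0pos.le
  have h2 : ((2 : ℝ) ^ crudeExp k k + S₀) / (1 + Real.sqrt (Real.log x)) * J ≤ η / 2 * S₀ := by
    have hle : (2 : ℝ) ^ crudeExp k k + S₀ ≤ (2 * (2 : ℝ) ^ crudeExp k k + 1) * S₀ := by
      have e : (2 * (2 : ℝ) ^ crudeExp k k + 1) * S₀ - ((2 : ℝ) ^ crudeExp k k + S₀) =
          (2 : ℝ) ^ crudeExp k k * (2 * S₀ - 1) := by ring
      have h0 : 0 ≤ (2 : ℝ) ^ crudeExp k k * (2 * S₀ - 1) :=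
        mul_nonneg (pow_nonneg (by norm_num) _) (by linarith)
      linarith
    calc ((2 : ℝ) ^ crudeExp k k + S₀) / (1 + Real.sqrt (Real.log x)) * J
        ≤ ((2 * (2 : ℝ) ^ crudeExp k k + 1) * S₀) / (1 + Real.sqrt (Real.log x)) * J := by
          gcongr
      _ = (2 * (2 : ℝ) ^ crudeExp k k + 1) * J / (1 + Real.sqrt (Real.log x)) * S₀ := by ring
      _ ≤ η / 2 * S₀ := mul_le_mul_of_nonneg_right hdecx hS0pos.le
  linarith

end Pair

end Maynard2016

end Literature.NumberTheory.Sieve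

end
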